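import Mathlib
import Summits.NavierStokesRegularity.NavierStokesRegularity.Theorems.EulerZoomLiouvillePowerGaugeEulerLiouvillePastFrameSteadyConfined
import Summits.NavierStokesRegularity.NavierStokesRegularity.Theorems.EulerZoomLiouvillePowerGaugeEulerLiouvilleRotoPeriodicTools
import HarnessLib

/-!
# ROTO-PERIODIC PAST MEMBERS ARE TRIVIAL — the rotational generalisation of the frame-periodic stratum
# (crux `EulerZoomLiouville.PowerGaugeEulerLiouville` = stmt-NavierStokesRegularity-19832; line `galilean_frames` symmetry strata; width seat ns-ezl-w3 g5)

Route №10 `EulerZoomLiouville` (NavierStokesRegularity), crux E.  A member `(u, p, H)` of Seregin's power-gauged class (`ρ > 0`) whose past is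
ROTO-PERIODIC — `u(τ, y) = R u(τ − P, R⁻¹(y − d)) + w` for all `τ < T₁ ≤ 0` (period `P > 0`; after one period the field returns conjugated by the
rigid motion `g(y) = Ry + d`, `R ∈ O(3)` ARBITRARY, and boosted by `w`) — VANISHES a.e. on the slab (`RotoPeriodic.ae_eq_zero_of_gauge_of_pastRotoPeriodic`).
`R = id` is the frame-periodic stratum `FramePeriodic.ae_eq_zero_of_gauge_of_pastFramePeriodic` (ns-ezl-w6 g2); irrational rotations `R` are NOT
reducible to it (no common period).  ROUTE = the frame-periodic one run slice-wise: (1) conjugate slices (`RotoPeriodic.weakGradient_ae_conj_slice`,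
tools file); (2) the ROTATED, HOPPED period boxes `(T₁ − (k+1)P, T₁ − kP) × B_r(c_k)`, `c_0 = 0`, `c_{k+1} = R⁻¹(c_k − d)` (`‖c_k‖ ≤ k‖d‖`), all carry the
mass of the last one (`RotoPeriodic.setLIntegral_periodBox_eq`, from `setLIntegral_box_shift` and `|RMR⁻¹|_F = |M|_F`); (3) `m` of them packed in `Q_a(0)`,
`a = m(‖d‖ + P + |r| + |T₁| + 1)`, give `m J ≤ c a^{1−ρ}`, so `J ≤ c S^{1−ρ} m^{−ρ} → 0` (`RotoPeriodic.setLIntegral_periodBox_eq_zero`, verbatim the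
frame-periodic arithmetic); (4) `H = 0` a.e. on every window `(T₁′ − P, T₁′) × ℝ³`, `T₁′ = T₁ − jP/2` (the hypotheses descend to `T₁′ ≤ T₁`), and these
windows cover `(−∞, T₁) × ℝ³`; (5) a.e. slice a.e. constant ⇒ zero energy ⇒ the member vanishes (tree lemmas, as in every stratum of the lineage).

WHAT THIS IS NOT: not NS regularity, not the crux E — one more CLOSED-FORM symmetry stratum of the crux CLASS 19832 (MODEL lattice; E/NS strata),
`--supports` stmt-19832; 19832 OPEN. [folklore]
-/

noncomputable section

-- flat `Theorems/<Route><Decl>…` files of one crux share the namespace of the crux (tree convention: `Summit.<S>.<S>.…`)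
set_option linter.dupNamespace false

open MeasureTheory Set Filter Topology Metric Function TopologicalSpace
open scoped ENNReal NNReal

namespace Summit.NavierStokesRegularity.NavierStokesRegularity.Theorems.PowerGaugeEulerLiouville

open Literature.Analysis Literature.Analysis.FunctionSpaces Literature.Analysis.FluidPDE

namespace RotoPeriodic

variable {u : ℝ → EuclideanSpace ℝ (Fin 3) → EuclideanSpace ℝ (Fin 3)}
  {H : ℝ → EuclideanSpace ℝ (Fin 3) → EuclideanSpace ℝ (Fin 3) →L[ℝ] EuclideanSpace ℝ (Fin 3)}
  {T₁ P : ℝ} {R : EuclideanSpace ℝ (Fin 3) ≃ₗᵢ[ℝ] EuclideanSpace ℝ (Fin 3)} {d w : EuclideanSpace ℝ (Fin 3)}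

/-! ## (2) Every rotated, hopped period box carries the same enstrophy mass -/

/-- The backward centres `c₀ = 0`, `c_{k+1} = R⁻¹(c_k − d)` stay in `B_{k‖d‖}`. [folklore] -/
theorem norm_centre_le {c : ℕ → EuclideanSpace ℝ (Fin 3)} (hc0 : c 0 = 0) (hcs : ∀ k, c (k + 1) = R.symm (c k - d)) (k : ℕ) :
    ‖c k‖ ≤ (k : ℝ) * ‖d‖ := by
  induction k with
  | zero => simp [hc0]
  | succ k ih =>
    rw [hcs k, LinearIsometryEquiv.norm_map, Nat.cast_succ]
    calc ‖c k - d‖ ≤ ‖c k‖ + ‖d‖ := norm_sub_le _ _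
      _ ≤ (k : ℝ) * ‖d‖ + ‖d‖ := by gcongr
      _ = ((k : ℝ) + 1) * ‖d‖ := by ring

/-- **Every rotated, hopped period box carries the same mass**: `∫_{(T₁−(k+1)P, T₁−kP) × B_r(c_k)} |H|²_F = ∫_{(T₁−P, T₁) × B_r(0)} |H|²_F`. [folklore] -/
theorem setLIntegral_periodBox_eq
    (hHm : AEStronglyMeasurable (uncurry H) (volume.restrict (Iio (0 : ℝ) ×ˢ (univ : Set (EuclideanSpace ℝ (Fin 3))))))
    (hT₁ : T₁ ≤ 0) (hP : 0 ≤ P)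
    (hconj : ∀ᵐ τ ∂(volume.restrict (Iio T₁)), H τ =ᵐ[volume] fun y =>
      (R : EuclideanSpace ℝ (Fin 3) →L[ℝ] EuclideanSpace ℝ (Fin 3)).comp
        ((H (τ - P) (R.symm (y - d))).comp (R.symm : EuclideanSpace ℝ (Fin 3) →L[ℝ] EuclideanSpace ℝ (Fin 3))))
    {c : ℕ → EuclideanSpace ℝ (Fin 3)} (hc0 : c 0 = 0) (hcs : ∀ k, c (k + 1) = R.symm (c k - d)) (r : ℝ) (k : ℕ) :
    ∫⁻ z in Ioo (T₁ - ((k : ℝ) + 1) * P) (T₁ - (k : ℝ) * P) ×ˢ ball (c k) r, ENNReal.ofReal (frobeniusNormSq (H z.1 z.2)) =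
      ∫⁻ z in Ioo (T₁ - P) T₁ ×ˢ ball (0 : EuclideanSpace ℝ (Fin 3)) r, ENNReal.ofReal (frobeniusNormSq (H z.1 z.2)) := by
  induction k with
  | zero => simp [hc0]
  | succ k ih =>
    have ht₂ : T₁ - (k : ℝ) * P ≤ T₁ := by
      have : 0 ≤ (k : ℝ) * P := by positivity
      linarith
    -- the box `k`, written around `R c_{k+1} + d = c_k`, shifts to the box `k + 1`
    have hcen : R (c (k + 1)) + d = c k := by rw [hcs k, LinearIsometryEquiv.apply_symm_apply, sub_add_cancel]
    have h := setLIntegral_box_shift hHm hT₁ hP hconj (t₁ := T₁ - ((k : ℝ) + 1) * P) ht₂ (c (k + 1)) r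
    rw [hcen] at h
    have e1 : T₁ - ((k : ℝ) + 1) * P - P = T₁ - (((k + 1 : ℕ) : ℝ) + 1) * P := by push_cast; ring
    have e2 : T₁ - (k : ℝ) * P - P = T₁ - ((k + 1 : ℕ) : ℝ) * P := by push_cast; ring
    rw [e1, e2] at h
    rw [← ih, ← h]

/-! ## (3) Packing `m` rotated boxes into `Q_a(0)`: the period mass vanishes -/

/-- **The period mass vanishes.**  If the slices of `H` are conjugate below `T₁ ≤ 0` (`P > 0`) and `a^ρ E(H; Q_a(0)) ≤ c` for all `a > 0` with `ρ > 0`,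
then `∫_{(T₁−P, T₁) × B_r} |H|²_F = 0` for every `r` (`m` disjoint rotated boxes in `Q_a(0)`, `a = m S`, `S = ‖d‖ + P + |r| + |T₁| + 1`; `m J ≤ c a^{1−ρ}`).
[folklore] -/
theorem setLIntegral_periodBox_eq_zero
    (hHm : AEStronglyMeasurable (uncurry H) (volume.restrict (Iio (0 : ℝ) ×ˢ (univ : Set (EuclideanSpace ℝ (Fin 3))))))
    (hT₁ : T₁ ≤ 0) (hP : 0 < P)
    (hconj : ∀ᵐ τ ∂(volume.restrict (Iio T₁)), H τ =ᵐ[volume] fun y =>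
      (R : EuclideanSpace ℝ (Fin 3) →L[ℝ] EuclideanSpace ℝ (Fin 3)).comp
        ((H (τ - P) (R.symm (y - d))).comp (R.symm : EuclideanSpace ℝ (Fin 3) →L[ℝ] EuclideanSpace ℝ (Fin 3))))
    {ρ : ℝ} (hρ : 0 < ρ) {c : ℝ≥0}
    (hE : ∀ a : ℝ, 0 < a → ENNReal.ofReal (a ^ ρ) * cknE a (0 : ℝ × EuclideanSpace ℝ (Fin 3)) H ≤ (c : ℝ≥0∞)) (r : ℝ) :
    ∫⁻ z in Ioo (T₁ - P) T₁ ×ˢ ball (0 : EuclideanSpace ℝ (Fin 3)) r, ENNReal.ofReal (frobeniusNormSq (H z.1 z.2)) = 0 := by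
  -- the backward centres
  set cen : ℕ → EuclideanSpace ℝ (Fin 3) := fun k => (fun x => R.symm (x - d))^[k] 0 with hcen
  have hc0 : cen 0 = 0 := rfl
  have hcs : ∀ k, cen (k + 1) = R.symm (cen k - d) := fun k => by
    rw [hcen]; exact Function.iterate_succ_apply' _ _ _
  set f : ℝ × EuclideanSpace ℝ (Fin 3) → ℝ≥0∞ := fun z => ENNReal.ofReal (frobeniusNormSq (H z.1 z.2)) with hf
  set J : ℝ≥0∞ := ∫⁻ z in Ioo (T₁ - P) T₁ ×ˢ ball (0 : EuclideanSpace ℝ (Fin 3)) r, f z with hJ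
  set S : ℝ := ‖d‖ + P + |r| + |T₁| + 1 with hS
  have hS1 : 1 ≤ S := by rw [hS]; linarith [norm_nonneg d, abs_nonneg r, abs_nonneg T₁, hP.le]
  have hS0 : 0 < S := by linarith
  -- the rotated boxes
  set box : ℕ → Set (ℝ × EuclideanSpace ℝ (Fin 3)) :=
    fun k => Ioo (T₁ - ((k : ℝ) + 1) * P) (T₁ - (k : ℝ) * P) ×ˢ ball (cen k) r with hbox
  have hboxm : ∀ k, MeasurableSet (box k) := fun k => measurableSet_Ioo.prod measurableSet_ball
  have hdisj : Pairwise (Disjoint on box) := by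
    intro i j hij
    rcases lt_or_gt_of_ne hij with h | h
    · refine Disjoint.set_prod_left (disjoint_left.2 fun τ h1 h2 => ?_) _ _
      have : ((i : ℝ) + 1) * P ≤ (j : ℝ) * P := mul_le_mul_of_nonneg_right (by exact_mod_cast h) hP.le
      linarith [h1.1, h2.2]
    · refine Disjoint.set_prod_left (disjoint_left.2 fun τ h1 h2 => ?_) _ _
      have : ((j : ℝ) + 1) * P ≤ (i : ℝ) * P := mul_le_mul_of_nonneg_right (by exact_mod_cast h) hP.le
      linarith [h1.2, h2.1]
  -- `J ≤ c S^{1−ρ} m^{−ρ}` for every `m ≥ 1`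
  have key : ∀ m : ℕ, 1 ≤ m → J ≤ ENNReal.ofReal ((c : ℝ) * S ^ (1 - ρ) * (m : ℝ) ^ (-ρ)) := by
    intro m hm
    have hm1 : (1 : ℝ) ≤ m := by exact_mod_cast hm
    set a : ℝ := (m : ℝ) * S with ha
    have ha1 : 1 ≤ a := by rw [ha]; nlinarith
    have ha0 : 0 < a := by linarith
    have hsub : (⋃ k ∈ Finset.range m, box k) ⊆ Ioo (-(a ^ 2)) 0 ×ˢ ball (0 : EuclideanSpace ℝ (Fin 3)) a := by
      intro z hz
      simp only [mem_iUnion, Finset.mem_range, exists_prop] at hz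
      obtain ⟨k, hk, hz⟩ := hz
      have hk' : (k : ℝ) + 1 ≤ m := by exact_mod_cast hk
      have hk0 : (0 : ℝ) ≤ k := k.cast_nonneg
      rw [hbox, mem_prod, mem_Ioo, mem_ball, dist_eq_norm] at hz
      refine mem_prod.2 ⟨⟨?_, ?_⟩, ?_⟩
      · have h1 : ((k : ℝ) + 1) * P ≤ (m : ℝ) * P := mul_le_mul_of_nonneg_right hk' hP.le
        have h2 : (m : ℝ) * P + |T₁| + 1 ≤ a := by
          rw [ha, hS]; nlinarith [norm_nonneg d, abs_nonneg r, abs_nonneg T₁]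
        have h3 : a ≤ a ^ 2 := by nlinarith
        linarith [hz.1.1, neg_abs_le T₁]
      · linarith [hz.1.2, mul_nonneg hk0 hP.le]
      · rw [mem_ball, dist_eq_norm, sub_zero]
        have h1 : ‖z.2‖ ≤ ‖z.2 - cen k‖ + ‖cen k‖ := norm_le_norm_sub_add _ _
        have h2 : ‖cen k‖ ≤ (m : ℝ) * ‖d‖ :=
          (norm_centre_le hc0 hcs k).trans (mul_le_mul_of_nonneg_right (by linarith) (norm_nonneg d))
        have h3 : (m : ℝ) * ‖d‖ + r < a := by
          have h4 : (1 : ℝ) * (P + |r| + |T₁| + 1) ≤ (m : ℝ) * (P + |r| + |T₁| + 1) :=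
            mul_le_mul_of_nonneg_right hm1 (by positivity)
          rw [ha, hS]; linarith [le_abs_self r, abs_nonneg T₁]
        linarith [hz.2]
    have h1 : (m : ℝ≥0∞) * J = ∫⁻ z in ⋃ k ∈ Finset.range m, box k, f z := by
      rw [lintegral_biUnion_finset (fun i _ j _ hij => hdisj hij) (fun k _ => hboxm k),
        Finset.sum_congr rfl fun k _ => setLIntegral_periodBox_eq hHm hT₁ hP.le hconj hc0 hcs r k, Finset.sum_const,
        Finset.card_range, nsmul_eq_mul]
    have h2 := TimePeriodic.setLIntegral_window_le_of_gaugeE (H := H) (T := a ^ 2) ha0 le_rfl le_rfl (hE a ha0)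
    have h3 : (m : ℝ≥0∞) * J ≤ ENNReal.ofReal ((c : ℝ) * a ^ (1 - ρ)) := by
      rw [h1]; exact (lintegral_mono_set hsub).trans h2
    have hm0 : (0 : ℝ) < m := by linarith
    have hm0' : (m : ℝ≥0∞) ≠ 0 := by exact_mod_cast (show (m : ℕ) ≠ 0 by exact_mod_cast hm0.ne')
    have h4 : J ≤ ENNReal.ofReal ((c : ℝ) * a ^ (1 - ρ)) / (m : ℝ≥0∞) := by
      rw [ENNReal.le_div_iff_mul_le (Or.inl hm0') (Or.inl (ENNReal.natCast_ne_top m)), mul_comm]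
      exact h3
    refine h4.trans (le_of_eq ?_)
    rw [← ENNReal.ofReal_natCast, ← ENNReal.ofReal_div_of_pos hm0]
    congr 1
    rw [ha, Real.mul_rpow hm0.le hS0.le, Real.rpow_sub hm0, Real.rpow_one, Real.rpow_neg hm0.le]
    field_simp
  have hlim : Tendsto (fun m : ℕ => ENNReal.ofReal ((c : ℝ) * S ^ (1 - ρ) * (m : ℝ) ^ (-ρ))) atTop (𝓝 0) := by
    have h1 : Tendsto (fun m : ℕ => ((m : ℝ)) ^ (-ρ)) atTop (𝓝 0) :=
      (tendsto_rpow_neg_atTop hρ).comp tendsto_natCast_atTop_atTop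
    have h2 := h1.const_mul ((c : ℝ) * S ^ (1 - ρ))
    rw [mul_zero] at h2
    have h3 := ENNReal.tendsto_ofReal h2
    rwa [ENNReal.ofReal_zero] at h3
  have key' : ∀ᶠ m : ℕ in atTop, J ≤ ENNReal.ofReal ((c : ℝ) * S ^ (1 - ρ) * (m : ℝ) ^ (-ρ)) :=
    (eventually_ge_atTop 1).mono key
  exact le_antisymm (le_of_tendsto_of_tendsto tendsto_const_nhds hlim key') bot_le

/-! ## (4) The weak gradient vanishes a.e. below `T₁` -/

/-- **`H = 0` a.e. on the last period window** `(T₁ − P, T₁) × ℝ³`. [folklore] -/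
theorem weakGradient_ae_zero_window
    (hH : HasWeakSpatialGradientOn (slab (EuclideanSpace ℝ (Fin 3)) (Iio 0) isOpen_Iio) u H) (hT₁ : T₁ ≤ 0) (hP : 0 < P)
    (hu : ∀ τ : ℝ, τ < T₁ → u τ = fun y => R (u (τ - P) (R.symm (y - d))) + w)
    {ρ : ℝ} (hρ : 0 < ρ) {c : ℝ≥0}
    (hE : ∀ a : ℝ, 0 < a → ENNReal.ofReal (a ^ ρ) * cknE a (0 : ℝ × EuclideanSpace ℝ (Fin 3)) H ≤ (c : ℝ≥0∞)) :
    ∀ᵐ z ∂(volume.restrict (Ioo (T₁ - P) T₁ ×ˢ (univ : Set (EuclideanSpace ℝ (Fin 3))))), H z.1 z.2 = 0 := by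
  have hHm : AEStronglyMeasurable (uncurry H) (volume.restrict (Iio (0 : ℝ) ×ˢ (univ : Set (EuclideanSpace ℝ (Fin 3))))) := by
    have := hH.locallyIntegrableOn_grad.aestronglyMeasurable
    simpa [slab] using this
  have hconj := weakGradient_ae_conj_slice hH hT₁ hP.le hu
  set f : ℝ × EuclideanSpace ℝ (Fin 3) → ℝ≥0∞ := fun z => ENNReal.ofReal (frobeniusNormSq (H z.1 z.2)) with hf
  have hIsub : Ioo (T₁ - P) T₁ ⊆ Iio (0 : ℝ) := fun τ hτ => lt_of_lt_of_le hτ.2 hT₁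
  have hfm : AEMeasurable f (volume.restrict (Ioo (T₁ - P) T₁ ×ˢ (univ : Set (EuclideanSpace ℝ (Fin 3))))) :=
    ((ENNReal.continuous_ofReal.comp LerayHopfProofs.continuous_frobeniusNormSq).comp_aestronglyMeasurable
      (hHm.mono_set (Set.prod_mono hIsub Subset.rfl))).aemeasurable
  have hball : ∀ n : ℕ, ∀ᵐ z ∂(volume.restrict (Ioo (T₁ - P) T₁ ×ˢ ball (0 : EuclideanSpace ℝ (Fin 3)) (n : ℝ))), f z = 0 := by
    intro n
    have h0 : ∫⁻ z in Ioo (T₁ - P) T₁ ×ˢ ball (0 : EuclideanSpace ℝ (Fin 3)) (n : ℝ), f z = 0 :=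
      setLIntegral_periodBox_eq_zero hHm hT₁ hP hconj hρ hE n
    exact (lintegral_eq_zero_iff' (hfm.mono_set (Set.prod_mono Subset.rfl (subset_univ _)))).1 h0
  have hU : (Ioo (T₁ - P) T₁ ×ˢ (univ : Set (EuclideanSpace ℝ (Fin 3)))) =
      ⋃ n : ℕ, (Ioo (T₁ - P) T₁ ×ˢ ball (0 : EuclideanSpace ℝ (Fin 3)) (n : ℝ)) := by
    rw [← prod_iUnion]
    congr 1
    ext y
    simp only [mem_univ, mem_iUnion, mem_ball, true_iff]
    exact exists_nat_gt _
  rw [hU, ae_restrict_iUnion_iff]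
  intro n
  filter_upwards [hball n] with z hz
  have h1 : frobeniusNormSq (H z.1 z.2) ≤ 0 := ENNReal.ofReal_eq_zero.1 hz
  have h2 : ‖H z.1 z.2‖ ^ 2 ≤ 0 := (sq_opNorm_le_frobeniusNormSq _).trans h1
  exact norm_eq_zero.1 (by nlinarith [norm_nonneg (H z.1 z.2)])

/-- **The weak gradient of a roto-periodic past member vanishes a.e. below `T₁`**: the windows `(T₁′ − P, T₁′) × ℝ³`, `T₁′ = T₁ − jP/2`, each carry
`H = 0` a.e. (the hypotheses descend to `T₁′ ≤ T₁`) and cover `(−∞, T₁) × ℝ³`. [folklore] -/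
theorem weakGradient_ae_zero_past
    (hH : HasWeakSpatialGradientOn (slab (EuclideanSpace ℝ (Fin 3)) (Iio 0) isOpen_Iio) u H) (hT₁ : T₁ ≤ 0) (hP : 0 < P)
    (hu : ∀ τ : ℝ, τ < T₁ → u τ = fun y => R (u (τ - P) (R.symm (y - d))) + w)
    {ρ : ℝ} (hρ : 0 < ρ) {c : ℝ≥0}
    (hE : ∀ a : ℝ, 0 < a → ENNReal.ofReal (a ^ ρ) * cknE a (0 : ℝ × EuclideanSpace ℝ (Fin 3)) H ≤ (c : ℝ≥0∞)) :
    ∀ᵐ z ∂(volume.restrict (Iio T₁ ×ˢ (univ : Set (EuclideanSpace ℝ (Fin 3))))), H z.1 z.2 = 0 := by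
  -- the windows at `T₁ − jP/2`
  have hwin : ∀ j : ℕ, ∀ᵐ z ∂(volume.restrict (Ioo (T₁ - (j : ℝ) * (P / 2) - P) (T₁ - (j : ℝ) * (P / 2)) ×ˢ
      (univ : Set (EuclideanSpace ℝ (Fin 3))))), H z.1 z.2 = 0 := by
    intro j
    have hj : T₁ - (j : ℝ) * (P / 2) ≤ T₁ := by
      have : 0 ≤ (j : ℝ) * (P / 2) := by positivity
      linarith
    exact weakGradient_ae_zero_window hH (hj.trans hT₁) hP (fun τ hτ => hu τ (lt_of_lt_of_le hτ hj)) hρ hE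
  have hcover : Iio T₁ ×ˢ (univ : Set (EuclideanSpace ℝ (Fin 3))) ⊆
      ⋃ j : ℕ, Ioo (T₁ - (j : ℝ) * (P / 2) - P) (T₁ - (j : ℝ) * (P / 2)) ×ˢ (univ : Set (EuclideanSpace ℝ (Fin 3))) := by
    intro z hz
    have hz1 : z.1 < T₁ := (mem_prod.1 hz).1
    simp only [mem_iUnion, mem_prod, mem_Ioo, mem_univ, and_true]
    -- `j = ⌈2(T₁ − z.1)/P⌉ − 1`
    set x : ℝ := (T₁ - z.1) / (P / 2) with hx
    have hx0 : 0 < x := div_pos (by linarith) (by linarith)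
    have hc1 : 1 ≤ ⌈x⌉₊ := Nat.one_le_iff_ne_zero.2 (by rw [Ne, Nat.ceil_eq_zero]; linarith)
    refine ⟨⌈x⌉₊ - 1, ?_, ?_⟩
    · -- lower end: `T₁ − z.1 < (⌈x⌉ + 1) P/2`
      have h1 : ((⌈x⌉₊ - 1 : ℕ) : ℝ) = (⌈x⌉₊ : ℝ) - 1 := by rw [Nat.cast_sub hc1, Nat.cast_one]
      have h3 : x * (P / 2) = T₁ - z.1 := by rw [hx]; field_simp
      have h5 : x * (P / 2) ≤ (⌈x⌉₊ : ℝ) * (P / 2) := mul_le_mul_of_nonneg_right (Nat.le_ceil x) (by linarith)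
      rw [h1]
      linarith
    · -- upper end: `(⌈x⌉ − 1) P/2 < T₁ − z.1`
      have h1 : ((⌈x⌉₊ - 1 : ℕ) : ℝ) = (⌈x⌉₊ : ℝ) - 1 := by rw [Nat.cast_sub hc1, Nat.cast_one]
      have h2 : (⌈x⌉₊ : ℝ) < x + 1 := Nat.ceil_lt_add_one hx0.le
      have h3 : x * (P / 2) = T₁ - z.1 := by rw [hx]; field_simp
      have h6 : ((⌈x⌉₊ : ℝ) - 1) * (P / 2) < x * (P / 2) := mul_lt_mul_of_pos_right (by linarith) (by linarith)
      rw [h1]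
      linarith
  refine ae_restrict_of_ae_restrict_of_subset hcover ?_
  rw [ae_restrict_iUnion_iff]
  exact hwin

/-! ## (5) The stratum -/

/-- **ROTO-PERIODIC PAST MEMBERS ARE TRIVIAL** (`ρ > 0`).  Let `(u, p)` be a suitable weak Euler pair on `(−∞,0) × ℝ³` with weak spatial gradient `H`
in Seregin's class `a^{2ρ}A(a) + a^{ρ}E(a) + a^{2ρ}D(a) ≤ c` (all `a > 0`), and suppose that below `T₁ ≤ 0` it is periodic up to a RIGID MOTION and a boost:
`u(τ, y) = R u(τ − P, R⁻¹(y − d)) + w` (`P > 0`, `R` any linear isometry of `ℝ³`).  Then `u = 0` a.e. on the slab. (`R = id`: the frame-periodic stratum.)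
[folklore] -/
theorem ae_eq_zero_of_gauge_of_pastRotoPeriodic {ρ : ℝ} (hρ : 0 < ρ) {p : ℝ → EuclideanSpace ℝ (Fin 3) → ℝ} {c : ℝ≥0}
    (hsw : IsSuitableWeakSolutionOn (slab (EuclideanSpace ℝ (Fin 3)) (Iio 0) isOpen_Iio) 0 0 u p)
    (hH : HasWeakSpatialGradientOn (slab (EuclideanSpace ℝ (Fin 3)) (Iio 0) isOpen_Iio) u H)
    (hc : ∀ a : ℝ, 0 < a → ENNReal.ofReal (a ^ (2 * ρ)) * cknA a (0 : ℝ × EuclideanSpace ℝ (Fin 3)) u +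
        ENNReal.ofReal (a ^ ρ) * cknE a (0 : ℝ × EuclideanSpace ℝ (Fin 3)) H +
        ENNReal.ofReal (a ^ (2 * ρ)) * cknD a (0 : ℝ × EuclideanSpace ℝ (Fin 3)) p ≤ (c : ℝ≥0∞))
    (hT₁ : T₁ ≤ 0) (hP : 0 < P) (hu : ∀ τ : ℝ, τ < T₁ → u τ = fun y => R (u (τ - P) (R.symm (y - d))) + w) :
    uncurry u =ᵐ[volume.restrict (Iio (0 : ℝ) ×ˢ (univ : Set (EuclideanSpace ℝ (Fin 3))))] 0 := by
  have hE : ∀ a : ℝ, 0 < a → ENNReal.ofReal (a ^ ρ) * cknE a (0 : ℝ × EuclideanSpace ℝ (Fin 3)) H ≤ (c : ℝ≥0∞) :=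
    fun a ha => le_trans (le_trans le_add_self le_self_add) (hc a ha)
  have hA : ∀ a : ℝ, 0 < a → ENNReal.ofReal (a ^ (2 * ρ)) * cknA a (0 : ℝ × EuclideanSpace ℝ (Fin 3)) u ≤ (c : ℝ≥0∞) :=
    fun a ha => le_trans (le_trans le_self_add le_self_add) (hc a ha)
  have hH0 := weakGradient_ae_zero_past hH hT₁ hP hu hρ hE
  have hslice := TypeIliouvilleNoTypeII.PowerGaugeSteady.ae_slice_const_of_weakGradient_ae_zero isOpen_Iio
    (hH.mono (slab_mono (Iio_subset_Iio hT₁))) hH0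
  have hzero : ∀ᵐ τ ∂(volume.restrict (Iio T₁)), ∫⁻ x, ‖u τ x‖ₑ ^ 2 = 0 := by
    filter_upwards [hslice, ae_restrict_mem measurableSet_Iio] with τ hτ hτT
    obtain ⟨b, hb⟩ := hτ
    exact PastPeriodic.lintegral_slice_eq_zero_of_ae_const_of_gaugeA hρ hA (lt_of_lt_of_le hτT hT₁) hb
  exact PastSymmetric.ae_eq_zero_of_gauge_of_pastSlicesZero hρ.le hsw hH hc hzero

end RotoPeriodic

end Summit.NavierStokesRegularity.NavierStokesRegularity.Theorems.PowerGaugeEulerLiouville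

end
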